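import Summits.SmoothPoincare4.SmoothPoincare4.Theses.EntropyRung
import Literature.Geometry.Riemannian.RicciFlowMaximal
import Literature.Geometry.Riemannian.PerelmanEntropy
import Literature.Topology.FourManifolds.HomotopyS4CompactProofs
import Summits.SmoothPoincare4.SmoothPoincare4.Theorems.EntropyRungSubcylindricalRecognitionCompactModelRecognition
import HarnessLib
import HarnessLib.Audit

/-!
# Line `type-split-bryant-ceiling` for crux `EntropyRung.SubcylindricalRecognition` (stmt-SmoothPoincare4-10869)

Skeleton (planner, round 1, 2026-08-16) of idea `type-split-bryant-ceiling`
(Cruxes/SubcylindricalRecognition/Ideas/type-split-bryant-ceiling.md), sharpened by the three triagers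
(TRIAGE-r1-1/2/3: type the Type-II recogniser over SINGULARITY MODELS of the compact flow, not over all
bounded-geometry eternal flows; no steady-sector stub; `ScalarPinching` off the critical path; keep the
Mantegazza–Müller Type-I half as the Bamler-free partial theorem `TypeIRung`).

## The line: split the first singular time by blow-up rate

Crux (RUNG): `M ≃ₕ S⁴` closed, `g` Riemannian, `R > 0`, `ν(g) > ν_cyl` (uniform gap `δ`) ⟹ `M ≃ₘ S⁴`.
From `R > 0` the maximal flow `g(t)` is singular at `T < ∞` and inherits the floor
`μ(g(t), τ) ≥ ν_cyl + δ` (Stub 1). Then EITHER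

* **Type I** (`|Rm| ≤ C/(T-t)`): by Mantegazza–Müller (arXiv:1205.4143, Thm 1.4/1.5/1.6, Prop 1.3,
  Lemma 4.2) the blow-up at a singular point `p` converges in the pointed Cheeger–Gromov sense — smoothly,
  with exhausting EMBEDDINGS `φ_j : U_j → M` — to a complete smooth bounded-curvature non-flat gradient
  shrinker `S` whose entropy is Perelman's limit density `Θ(p) = lim θ_p(t) ≥ lim inf μ(g(t), T-t) ≥
  ν_cyl + δ`, WITHOUT LOSS; renormalised to the route's currency `R + |∇f|² = f` this is
  `∫ e^{-f} dV = 16π² e^{Θ(p)} > 16π² Θ(S³×ℝ) = 32π²√π e^{-3/2}`, and if `S` is compact the `φ_j` are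
  injective immersions `S → M` (Stub 2 — NO Bamler theory, NO orbifold points, NO cone exclusion: Type-I
  limits are smooth with `|Rm| ≤ C`); OR
* **Type II**: Hamilton's Type-II point picking (Hamilton 1995 §16; Chow–Lu–Ni Prop. 8.17) produces
  rescaled flows on `M × [-A_k, B_k]` with `A_k, B_k → ∞`, `|Rm| ≤ 1`, an anchor `|Rm|(x_k, 0) ≥ c` and
  the floor (Stub 3, fact-free); such a TWO-SIDED ("eternal") sequence above the cylinder has a
  NON-COMPACT blow-down shrinker of density `> Θ(S³×ℝ)` (Stub 4 = the card's ETERNAL CEILING in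
  blow-down form, typed over singularity models as the triage asked: Bamler's tangent flow at `-∞` of the
  backward halves is a smooth complete shrinker `S` of density `≥ e^{ν_cyl+δ} > 1/2` — no cone points —
  and a COMPACT `S` is impossible for a two-sided sequence: smooth global convergence at one backward time
  gives `R ≥ ρ/2λ > 0` on a compact slice, hence extinction within `4λ/ρ`, against existence up to
  `B_k → ∞`).

The route's gaps finish both branches: `NoncompactShrinkerGap` (#2, stmt-…-10868) kills every non-compact
dense shrinker — so Type II is IMPOSSIBLE above the cylinder (`EntropyTypeI_of`, the card's conjecture
"super-cylindrical entropy forbids Type II", here a theorem modulo Stubs 1, 3, 4 and #2 alone, no #4) — and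
in the Type-I branch a compact `S` immerses injectively into the connected `M`, so `S ≅ M ≃ₕ S⁴`
(`stub_compactModelRecognition`, LANDED p72507, imported) and `CompactShrinkerGap` (#4, stmt-…-10870)
returns `S ≃ₘ S⁴` (`TypeIRung_of`, which needs #2 only for BOUNDED-CURVATURE shrinkers:
`NoncompactShrinkerGapBdd`). `SubcylindricalRecognition_of h₂ h₄` is the card's `rung_of_typeSplit` applied to the two.

## Registered stubs (4; sorries only here)

1. `stub_maximalFlow` — closed connected `(M⁴, g₀)`, `R > 0`, unfolded floor `δ` ⟹ a maximal Ricci flow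
   from `g₀` EXISTS, and EVERY maximal flow from `g₀` has curvature blow-up and the floor `μ ≥ ν_cyl + δ`
   along `[0, T)`. Hamilton 1982 Thm 14.1 + Topping Cor 3.2.4 / Thm 5.3.1 + Perelman (3.4); closes modulo
   the named facts F1 `ricciFlow_shortTime_existence`, F2 `perelman_muEntropy_monotone` by re-assembling
   `Theorems/EntropyRungSubcylindricalRecognitionSingularFlow.lean` (p72410; universal form of the sibling's
   `stub_singularFlow`; the NLC clause is dropped — it follows from the floor,
   `Theorems/SubcylindricalRecognition/Negative/StubBlowdownFloorNoncollapsing.lean`).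
2. `stub_typeIBlowdown` — Mantegazza–Müller Type-I blow-up at a singular point, in the route's currency
   (LOAD-BEARING for `TypeIRung`; Bamler-free). [MantegazzaMuller2015 = arXiv:1205.4143 = doi
   10.1515/crelle-2013-0039; EndersMullerTopping2011 = arXiv:1005.1624; renormalisation =
   `stub_renormalise` LANDED p74584.]
3. `stub_typeIITwoSidedSequence` — Hamilton's Type-II point picking + parabolic rescaling, fact-free
   (two-sided analogue of the LANDED `stub_pointPicking` p71490 / `stub_rescaledSequence` p71836).
4. `stub_twoSidedBlowdown` — HARDEST: a two-sided bounded-curvature sequence above the cylinder on a closed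
   connected 4-manifold has a NON-COMPACT complete normalised shrinker of density `> Θ(S³×ℝ)` with `R ≢ 0`
   (Bamler 2020a–c via the LANDED named fact `bamler_orbifoldTangentFlowAtInfinity_four` on the backward
   halves + the sibling's fact-free cone-exclusion kit + smooth convergence on a compact regular slice
   (2020c Thm 2.4) + Topping Cor 3.2.4 forward in time).

Composition and by-products (all sorry-free): `IsTypeI`, `TypeIRung`, `EntropyTypeI`,
`NoncompactShrinkerGapBdd`, `noncompactShrinkerGapBdd_of`, `TypeIRung_of`, `EntropyTypeI_of`,
`SubcylindricalRecognition_of` (= the card's `rung_of_typeSplit`, inlined).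

Disproof.lean (cdisprove cycle 3) honoured: `false_without_homotopyEquiv` — `M ≃ₕ S⁴` is consumed twice
(connectedness of `M`; `S ≃ₕ S⁴` for `h₄`); `spc4_imp`/`iff_exoticFree` — no stub restates RUNG: Stubs 1, 3
hold on every closed 4-manifold, Stub 2's conclusion is `BlowdownConclusion M` plus a curvature bound
(§8.1: SPC4-trivialisable on `M ≅ S⁴` exactly like the sibling's `stub_blowdown`, informative elsewhere),
Stub 4's conclusion does not mention `M` at all (it is FALSE if #2 holds and two-sided sequences exist —
i.e. it asserts, given #2, that super-cylindrical two-sided sequences do not exist; and it is trivially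
true if #2 fails, when the route dies at #2 anyway — recorded, not hidden); `half_lt_thetaCyl` is the cone
margin used inside Stub 4; §6 note 5 ("`R > 0` … used by type-split") — here `R > 0` is used only for
`T < ∞` (Stub 1), `ScalarPinching` being off the critical path per TRIAGE-r1-3; no landed Negative lemma
(`Negative/{Shape, WindowArithmetic, RoundSphereTightness, StubBlowdownDecoupling,
StubBlowdownFloorNoncollapsing}`) refutes an instance of any stub (they are shape/arithmetic/positive
results).
-/

noncomputable section

set_option linter.dupNamespace false

open scoped Manifold ContDiff Topology ENNReal NNReal ContinuousMap
open Set MeasureTheory Filter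
open Literature.Geometry.Lorentzian Literature.Geometry.Riemannian

namespace Summit.SmoothPoincare4.SmoothPoincare4.Cruxes.SubcylindricalRecognition.TypeSplitBryantCeiling

/-! ## Vocabulary of the line (documentation defs; stub signatures below are spelled over tree vocabulary only) -/

section Defs

variable {M : Type*} [TopologicalSpace M] [ChartedSpace (EuclideanSpace ℝ (Fin 4)) M]
  [IsManifold (𝓡 4) ∞ M]

/-- **Type I** (Hamilton 1995, §16; Mantegazza–Müller arXiv:1205.4143, (1.2)): a flow `(g, cov)` with
final time `T` is of Type I if `|Rm_{g(t)}| ≤ C/(T - t)` on `[0, T)` for some `C` (frame form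
`CurvatureBoundedBy`). Its negation on a maximal flow is "Type II(a)":
`sup_{M×[0,T)} (T-t)|Rm| = ∞`. [cite: Hamilton1995, §16] -/
def IsTypeI (g : ℝ → PseudoRiemannianMetric (𝓡 4) ∞ (EuclideanSpace ℝ (Fin 4)) (TangentSpace (𝓡 4) : M → Type _))
    (cov : ℝ → CovariantDerivative (𝓡 4) (EuclideanSpace ℝ (Fin 4)) (TangentSpace (𝓡 4) : M → Type _))
    (T : ℝ) : Prop :=
  ∃ C : ℝ, ∀ t ∈ Set.Ico 0 T, CurvatureBoundedBy (g t) (cov t) (C / (T - t))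

end Defs

/-- **`TypeIRung`** (the card's Bamler-free half): RUNG for metrics all of whose maximal Ricci flows are
of Type I — the crux's binder and hypotheses verbatim, plus the Type-I hypothesis, same conclusion. Proved
below from Stubs 1–2, `stub_compactModelRecognition` (landed) and the two gaps (`TypeIRung_of`), with #2
weakened to bounded-curvature shrinkers. -/
def TypeIRung : Prop :=
  ∀ (M : Type) [TopologicalSpace M] [T2Space M] [SecondCountableTopology M]
    [ChartedSpace (EuclideanSpace ℝ (Fin 4)) M] [IsManifold (𝓡 4) ∞ M] [CompactSpace M] [T3Space M]
    [MeasurableSpace M] [BorelSpace M],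
    M ≃ₕ Metric.sphere (0 : EuclideanSpace ℝ (Fin 5)) 1 →
    ∀ (g : PseudoRiemannianMetric (𝓡 4) ∞ (EuclideanSpace ℝ (Fin 4)) (TangentSpace (𝓡 4) : M → Type _))
      [g.HasLeviCivita] (hg : g.IsRiemannian),
      (∀ x : M, 0 < g.scalarCurvature x) →
      (∃ δ : ℝ, 0 < δ ∧ ∀ τ : ℝ, 0 < τ → ∀ f : M → ℝ, ContMDiff (𝓡 4) 𝓘(ℝ, ℝ) ∞ f →
        ∫ x, (4 * Real.pi * τ) ^ (-(4 : ℝ) / 2) * Real.exp (-f x)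
          ∂(riemannianMeasure (g.toContMDiffRiemannianMetric hg)) = 1 →
        Real.log 2 + Real.log Real.pi / 2 - 3 / 2 + δ ≤
          ∫ x, (τ * (g.scalarCurvature x + g.gradSq f x) + f x - 4) *
            ((4 * Real.pi * τ) ^ (-(4 : ℝ) / 2) * Real.exp (-f x))
            ∂(riemannianMeasure (g.toContMDiffRiemannianMetric hg))) →
      (∀ (T : ℝ)
        (gt : ℝ → PseudoRiemannianMetric (𝓡 4) ∞ (EuclideanSpace ℝ (Fin 4)) (TangentSpace (𝓡 4) : M → Type _))
        (cov : ℝ → CovariantDerivative (𝓡 4) (EuclideanSpace ℝ (Fin 4)) (TangentSpace (𝓡 4) : M → Type _)),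
        IsMaximalRicciFlow gt cov T → gt 0 = g → IsTypeI gt cov T) →
      Nonempty (M ≃ₘ⟮𝓡 4, 𝓡 4⟯ (Metric.sphere (0 : EuclideanSpace ℝ (Fin 5)) 1))

/-- **`EntropyTypeI`** (the card's conjecture C⁺, "super-cylindrical entropy forbids Type II"): on a
closed connected 4-manifold, a Riemannian metric with `R > 0` and `ν > ν_cyl` (the crux's unfolded
floor) has only Type-I maximal Ricci flows. No homotopy hypothesis: it has content on `S⁴` itself (no
degenerate neckpinch above the cylinder entropy). Sharp: the Bryant soliton and Perelman's ovals have
`inf_t ν = ν_cyl` exactly (Chan–Ma–Zhang arXiv:2106.06904 Thm 1.4). Proved below MODULO Stubs 1, 3, 4 and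
`NoncompactShrinkerGap` (`EntropyTypeI_of`); dimension-3 analogue is a theorem (Perelman + Brendle:
Type-II models are Bryant, whose blow-down is the cylinder). -/
def EntropyTypeI : Prop :=
  ∀ (M : Type) [TopologicalSpace M] [T2Space M] [SecondCountableTopology M]
    [ChartedSpace (EuclideanSpace ℝ (Fin 4)) M] [IsManifold (𝓡 4) ∞ M] [CompactSpace M]
    [ConnectedSpace M] [T3Space M] [MeasurableSpace M] [BorelSpace M]
    (g : PseudoRiemannianMetric (𝓡 4) ∞ (EuclideanSpace ℝ (Fin 4)) (TangentSpace (𝓡 4) : M → Type _))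
    [g.HasLeviCivita] (hg : g.IsRiemannian),
    (∀ x : M, 0 < g.scalarCurvature x) →
    (∃ δ : ℝ, 0 < δ ∧ ∀ τ : ℝ, 0 < τ → ∀ f : M → ℝ, ContMDiff (𝓡 4) 𝓘(ℝ, ℝ) ∞ f →
      ∫ x, (4 * Real.pi * τ) ^ (-(4 : ℝ) / 2) * Real.exp (-f x)
        ∂(riemannianMeasure (g.toContMDiffRiemannianMetric hg)) = 1 →
      Real.log 2 + Real.log Real.pi / 2 - 3 / 2 + δ ≤
        ∫ x, (τ * (g.scalarCurvature x + g.gradSq f x) + f x - 4) *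
          ((4 * Real.pi * τ) ^ (-(4 : ℝ) / 2) * Real.exp (-f x))
          ∂(riemannianMeasure (g.toContMDiffRiemannianMetric hg))) →
    ∀ (T : ℝ)
      (gt : ℝ → PseudoRiemannianMetric (𝓡 4) ∞ (EuclideanSpace ℝ (Fin 4)) (TangentSpace (𝓡 4) : M → Type _))
      (cov : ℝ → CovariantDerivative (𝓡 4) (EuclideanSpace ℝ (Fin 4)) (TangentSpace (𝓡 4) : M → Type _)),
      IsMaximalRicciFlow gt cov T → gt 0 = g → IsTypeI gt cov T

/-- **`NoncompactShrinkerGapBdd`**: `NoncompactShrinkerGap` (#2, stmt-SmoothPoincare4-10868) restricted to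
shrinkers of BOUNDED CURVATURE (`∃ cov C, IsLeviCivita ∧ |Rm| ≤ C`) — all that the Type-I branch consumes,
because Type-I blow-up limits have `|Rm| ≤ C_I` (Mantegazza–Müller Thm 1.4). Trivially implied by #2
(`noncompactShrinkerGapBdd_of`); strictly weaker as a dependency (the residual class of #2 after the
end-density-ceiling / spineless sieves contains a bounded-curvature conjunct, TRIAGE-r1-3). -/
def NoncompactShrinkerGapBdd : Prop :=
  ∀ (M : Type) [TopologicalSpace M] [T2Space M] [SecondCountableTopology M] [ChartedSpace (EuclideanSpace ℝ (Fin 4)) M] [IsManifold (𝓡 4) ∞ M] [ConnectedSpace M] [NoncompactSpace M] [T3Space M] [MeasurableSpace M] [BorelSpace M] (g : Literature.Geometry.Lorentzian.PseudoRiemannianMetric (𝓡 4) ∞ (EuclideanSpace ℝ (Fin 4)) (TangentSpace (𝓡 4) : M → Type _)) [g.HasLeviCivita] (f : M → ℝ) (hg : g.IsRiemannian), (∀ (x : M) (r : NNReal), IsCompact {y : M | g.edist hg x y ≤ r}) → ContMDiff (𝓡 4) 𝓘(ℝ, ℝ) ∞ f → (∀ (x : M) (X Y : TangentSpace (𝓡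 4) x), g.ricci x X Y + g.hessian f x X Y = (1 / 2 : ℝ) * g.val x X Y) → (∀ x : M, g.scalarCurvature x + g.gradSq f x = f x) → (∃ x : M, g.scalarCurvature x ≠ 0) →
    (∃ (cov : CovariantDerivative (𝓡 4) (EuclideanSpace ℝ (Fin 4)) (TangentSpace (𝓡 4) : M → Type _)) (C : ℝ),
      g.IsLeviCivita cov ∧ CurvatureBoundedBy g cov C) →
    ∫⁻ x, ENNReal.ofReal (Real.exp (-f x)) ∂(Literature.Geometry.Lorentzian.riemannianMeasure (g.toContMDiffRiemannianMetric hg)) ≤ ENNReal.ofReal (32 * Real.pi ^ 2 * Real.sqrt Real.pi * Real.exp (-(3 : ℝ) / 2))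

/-- #2 implies its bounded-curvature restriction (drop a hypothesis). [folklore] -/
theorem noncompactShrinkerGapBdd_of
    (h₂ : _root_.Summit.SmoothPoincare4.SmoothPoincare4.Theses.EntropyRung.NoncompactShrinkerGap) :
    NoncompactShrinkerGapBdd :=
  fun M _ _ _ _ _ _ _ _ _ _ g _ f hg hc hf hsol hnorm hnf _ ↦ h₂ M g f hg hc hf hsol hnorm hnf

/-! ## Stub 1 — the maximal flow: existence, blow-up and Perelman's floor along EVERY maximal flow -/

/-- **Stub 1 (`stub_maximalFlow`).** For a Riemannian `g₀` with `R > 0` on a closed connected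
4-manifold satisfying the crux's unfolded floor `𝒲(g₀, f, τ) ≥ ν_cyl + δ` (all `τ > 0`, all smooth
compatible `f`): (i) a maximal Ricci flow `(g, cov)` on some `[0, T)` with `g 0 = g₀` EXISTS (Hamilton
1982, Thm 14.1; the immortal alternative is excluded by `R_min > 0`, Topping 2006 Cor 3.2.4, tree
`IsRicciFlow.singularTime_le`); (ii) EVERY maximal flow from `g₀` has unbounded curvature as `t ↑ T`
(Topping 2006, Thm 5.3.1) and satisfies `μ(g(t), τ) ≥ ν_cyl + δ` for `t ∈ [0, T)`, `τ > 0`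
(Perelman 2002, (3.4): `μ(g(t), τ) ≥ μ(g₀, τ + t)`; the unfolded floor is `(ν_cyl + δ : EReal) ≤
μ(g₀, cov₀, τ)` for every Levi-Civita witness, `coe_le_muEntropy_iff_integral`). Universal form of the
sibling line's `stub_singularFlow`; closes modulo F1 = `ricciFlow_shortTime_existence` and F2 =
`perelman_muEntropy_monotone` by the lemmas of
`Theorems/EntropyRungSubcylindricalRecognitionSingularFlow.lean` (p72410). The `κ`-noncollapsing clause is
deliberately absent (it follows from the floor: `Negative/StubBlowdownFloorNoncollapsing.lean`).
[cite: Perelman2002Entropy, §3.1, (3.4)] [cite: Topping2006, Cor 3.2.4, Thm 5.3.1, (8.3.10)] -/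
theorem stub_maximalFlow :
    ∀ (M : Type) [TopologicalSpace M] [T2Space M] [SecondCountableTopology M]
      [ChartedSpace (EuclideanSpace ℝ (Fin 4)) M] [IsManifold (𝓡 4) ∞ M] [CompactSpace M]
      [ConnectedSpace M] [T3Space M] [MeasurableSpace M] [BorelSpace M]
      (g₀ : PseudoRiemannianMetric (𝓡 4) ∞ (EuclideanSpace ℝ (Fin 4)) (TangentSpace (𝓡 4) : M → Type _))
      [g₀.HasLeviCivita] (hg₀ : g₀.IsRiemannian),
      (∀ x : M, 0 < g₀.scalarCurvature x) →
      ∀ δ : ℝ, 0 < δ →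
      (∀ τ : ℝ, 0 < τ → ∀ f : M → ℝ, ContMDiff (𝓡 4) 𝓘(ℝ, ℝ) ∞ f →
        ∫ x, (4 * Real.pi * τ) ^ (-(4 : ℝ) / 2) * Real.exp (-f x)
          ∂(riemannianMeasure (g₀.toContMDiffRiemannianMetric hg₀)) = 1 →
        Real.log 2 + Real.log Real.pi / 2 - 3 / 2 + δ ≤
          ∫ x, (τ * (g₀.scalarCurvature x + g₀.gradSq f x) + f x - 4) *
            ((4 * Real.pi * τ) ^ (-(4 : ℝ) / 2) * Real.exp (-f x))
            ∂(riemannianMeasure (g₀.toContMDiffRiemannianMetric hg₀))) →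
      (∃ (T : ℝ)
          (g : ℝ → PseudoRiemannianMetric (𝓡 4) ∞ (EuclideanSpace ℝ (Fin 4)) (TangentSpace (𝓡 4) : M → Type _))
          (cov : ℝ → CovariantDerivative (𝓡 4) (EuclideanSpace ℝ (Fin 4)) (TangentSpace (𝓡 4) : M → Type _)),
          IsMaximalRicciFlow g cov T ∧ g 0 = g₀) ∧
      (∀ (T : ℝ)
          (g : ℝ → PseudoRiemannianMetric (𝓡 4) ∞ (EuclideanSpace ℝ (Fin 4)) (TangentSpace (𝓡 4) : M → Type _))
          (cov : ℝ → CovariantDerivative (𝓡 4) (EuclideanSpace ℝ (Fin 4)) (TangentSpace (𝓡 4) : M → Type _)),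
          IsMaximalRicciFlow g cov T → g 0 = g₀ →
          (∀ C : ℝ, ∃ t₀ ∈ Set.Ico 0 T, ∀ t ∈ Set.Ico t₀ T, ¬ CurvatureBoundedBy (g t) (cov t) C) ∧
          (∀ t ∈ Set.Ico 0 T, ∀ τ : ℝ, 0 < τ →
            ((Real.log 2 + Real.log Real.pi / 2 - 3 / 2 + δ : ℝ) : EReal) ≤
              (g t).muEntropy (cov t) τ)) := by
  sorry

/-! ## Stub 2 — Type I: Mantegazza–Müller's blow-up at a singular point, in the route's currency -/

/-- **Stub 2 (`stub_typeIBlowdown`) — the Type-I recogniser input, Bamler-free.** Let `(g, cov)` be a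
maximal Ricci flow on `[0, T)` on a closed connected 4-manifold `M` with unbounded curvature as `t ↑ T`,
of TYPE I (`|Rm| ≤ C/(T-t)`), with the floor `μ(g(t), τ) ≥ ν_cyl + δ` (`δ > 0`). Then there is a
complete connected gradient shrinker `(S, g_S, f_S)` in the currency of items 10868/10870 —
`Ric + Hess f_S = g_S/2`, `R + |∇f_S|² = f_S`, `f_S` smooth, closed balls compact, `R ≢ 0`,
`∫ e^{-f_S} dV > 32π²√π e^{-3/2}` (= `16π² Θ(S³×ℝ)`) — of BOUNDED CURVATURE, which, if compact, immerses
injectively and smoothly into `M`.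
PROOF IN PRINT: `M` compact and `sup|Rm(·,t)| → ∞` give a singular point `p` (a point with no
neighbourhood on which `|Rm|` stays bounded as `t → T`; else finitely many bounded neighbourhoods cover
`M`) and Topping's lower rate `sup|Rm| ≥ 1/8(T-t)`, so the flow is a "compact singular Type I flow" in the
sense of Mantegazza–Müller (arXiv:1205.4143, (1.1)–(1.2)). Their Thm 1.4 (cf. Naber 2010,
Enders–Müller–Topping 2011): the `s = -1` slices of the blow-up sequence `λ_j g(T + s/λ_j)` at `p`
converge smoothly in the pointed Cheeger–Gromov sense — exhaustion `U_j ∋ p_∞` of `S`, smooth EMBEDDINGS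
`φ_j : U_j → M` — to a complete NORMALISED shrinker `(S, g_∞, f_∞)`: `Ric + ∇²f_∞ = g_∞/2`,
`∫ (4π)⁻² e^{-f_∞} = 1`, with `|Rm_∞| ≤ C_I` (Type I) ; Thm 1.5: `p` singular ⇒ `S` non-flat; Thm 1.6 (no
loss of entropy) with Prop 1.3: `𝒲(g_∞, f_∞) = Θ(p) = lim_{t→T} θ_p(t)` and `θ_p(t) = 𝒲(g(t), f̂_{p,T}(t),
T-t) ≥ μ(g(t), T-t) ≥ ν_cyl + δ` (the floor, at scale `τ = T - t`); Lemma 4.2: `R_∞ > 0` everywhere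
(Zhang/Yokota/PRS, `S` non-flat) and `𝒲(g_∞, f_∞) = -a`, `a = R + |∇f_∞|² - f_∞` the auxiliary constant,
so `f_S := f_∞ + a` has `R + |∇f_S|² = f_S` and `∫ e^{-f_S} dV = 16π² e^{Θ(p)} ≥ 16π² e^{ν_cyl+δ} >
16π²·2√π e^{-3/2}` — this last step is VERBATIM the landed `stub_renormalise` (p74584, hypotheses
`R + |∇f|² = f - W`, `∫⁻e^{-f} = 16π²`, `ν_cyl + δ ≤ W`, `R > 0`, with `W = Θ(p) = -a`); finally a compact
`S` is exhausted at a finite stage, `U_j = S`, and `φ_j` is an injective immersion. To vendor: ONE named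
fact (MM Thm 1.4 + 1.5 + 1.6 + Prop 1.3 + Lemma 4.2 in existential dress over `IsMaximalRicciFlow`,
`CurvatureBoundedBy`, `muEntropy`). Size L. Non-vacuity: the shrinking round `S⁴` (Type I) with
`S = S⁴(√6)`, `∫e^{-2}dV = 96π²e⁻² > 32π²√π e^{-3/2}` (tree `ShrinkingRoundSphereFour`).
[cite: MantegazzaMuller2015, Thm 1.4, Thm 1.5, Thm 1.6, Prop 1.3, Lemma 4.2]
[cite: EndersMullerTopping2011, Thm 1.1] [cite: Topping2006, Lemma 5.3.2, (5.3.1)] -/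
theorem stub_typeIBlowdown :
    ∀ (M : Type) [TopologicalSpace M] [T2Space M] [SecondCountableTopology M]
      [ChartedSpace (EuclideanSpace ℝ (Fin 4)) M] [IsManifold (𝓡 4) ∞ M] [CompactSpace M]
      [ConnectedSpace M] [T3Space M] [MeasurableSpace M] [BorelSpace M] (T δ : ℝ), 0 < δ →
      ∀ (g : ℝ → PseudoRiemannianMetric (𝓡 4) ∞ (EuclideanSpace ℝ (Fin 4)) (TangentSpace (𝓡 4) : M → Type _))
        (cov : ℝ → CovariantDerivative (𝓡 4) (EuclideanSpace ℝ (Fin 4)) (TangentSpace (𝓡 4) : M → Type _)),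
      IsMaximalRicciFlow g cov T →
      (∀ C : ℝ, ∃ t₀ ∈ Set.Ico 0 T, ∀ t ∈ Set.Ico t₀ T, ¬ CurvatureBoundedBy (g t) (cov t) C) →
      (∃ C : ℝ, ∀ t ∈ Set.Ico 0 T, CurvatureBoundedBy (g t) (cov t) (C / (T - t))) →
      (∀ t ∈ Set.Ico 0 T, ∀ τ : ℝ, 0 < τ →
        ((Real.log 2 + Real.log Real.pi / 2 - 3 / 2 + δ : ℝ) : EReal) ≤ (g t).muEntropy (cov t) τ) →
      ∃ (S : Type) (_ : TopologicalSpace S) (_ : T2Space S) (_ : SecondCountableTopology S)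
        (_ : ChartedSpace (EuclideanSpace ℝ (Fin 4)) S) (_ : IsManifold (𝓡 4) ∞ S) (_ : ConnectedSpace S)
        (_ : T3Space S) (_ : MeasurableSpace S) (_ : BorelSpace S)
        (gS : PseudoRiemannianMetric (𝓡 4) ∞ (EuclideanSpace ℝ (Fin 4)) (TangentSpace (𝓡 4) : S → Type _))
        (_ : gS.HasLeviCivita) (fS : S → ℝ) (hS : gS.IsRiemannian),
        (∀ (x : S) (r : NNReal), IsCompact {y : S | gS.edist hS x y ≤ r}) ∧
        ContMDiff (𝓡 4) 𝓘(ℝ, ℝ) ∞ fS ∧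
        (∀ (x : S) (X Y : TangentSpace (𝓡 4) x),
          gS.ricci x X Y + gS.hessian fS x X Y = (1 / 2 : ℝ) * gS.val x X Y) ∧
        (∀ x : S, gS.scalarCurvature x + gS.gradSq fS x = fS x) ∧
        (∃ x : S, gS.scalarCurvature x ≠ 0) ∧
        ENNReal.ofReal (32 * Real.pi ^ 2 * Real.sqrt Real.pi * Real.exp (-(3 : ℝ) / 2)) <
          ∫⁻ x, ENNReal.ofReal (Real.exp (-fS x))
            ∂(riemannianMeasure (gS.toContMDiffRiemannianMetric hS)) ∧
        (∃ (covS : CovariantDerivative (𝓡 4) (EuclideanSpace ℝ (Fin 4)) (TangentSpace (𝓡 4) : S → Type _))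
          (C : ℝ), gS.IsLeviCivita covS ∧ CurvatureBoundedBy gS covS C) ∧
        (CompactSpace S → ∃ φ : S → M, ContMDiff (𝓡 4) (𝓡 4) ∞ φ ∧ Function.Injective φ ∧
          ∀ x : S, Function.Injective (mfderiv (𝓡 4) (𝓡 4) φ x)) := by
  sorry

/-! ## Stub 3 — Type II: Hamilton's point picking gives a two-sided ("eternal") rescaled sequence -/

/-- **Stub 3 (`stub_typeIITwoSidedSequence`) — fact-free.** Let `(g, cov)` be a maximal Ricci flow on
`[0, T)` on a closed connected 4-manifold which is NOT of Type I, with the floor `μ(g(t), τ) ≥ ν_cyl + δ`.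
Then there are `c, δ' > 0` and, for every `k`, a Ricci flow `g_k` on `M × [-A_k, B_k]` with `A_k ≥ k`
AND `B_k ≥ k`, Riemannian, `|Rm| ≤ 1` throughout (frame form), a `g_k(0)`-sub-unit quadruple at `x_k` with
`|Rm| ≥ c`, and the floor `μ(g_k(t), τ) ≥ ν_cyl + δ'` throughout.
PROOF (Hamilton 1995, §16, Type IIa; Chow–Lu–Ni 2006, Prop 8.17 / Chow et al. Part III, Prop A.70 with
`|Rm|` in place of `R`): pick `T_j ↑ T`; `S_j := sup_{M×[0,T_j]} (T_j - t) q(x,t)`, `q` = the frame size of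
`Rm` (finite on `M × [0, T_j]`: tree `IsRicciFlow.exists_curvatureBoundedBy_Icc`); `¬` Type I gives
`sup_j S_j = ∞` (given `C`, some `(x,t)` has `(T-t) q > 2C`, then `T_j > (T+t)/2` gives `(T_j-t)q > C`);
choose `(x_k, t_k)`, `t_k ≤ T_{j_k}`, and a sub-unit quadruple of value `Q_k` with
`(T_{j_k} - t_k) Q_k ≥ S_{j_k}/2 ≥ k`-ish; as in the landed `stub_pointPicking`, `t_k > T/2` once
`S_j/2 > T · sup_{M×[0,T/2]} q`, so `Q_k → ∞`; for `t ∈ [0, T_{j_k}]`,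
`q(·,t) ≤ S_{j_k}/(T_{j_k} - t) ≤ 2 (T_{j_k}-t_k) Q_k /(T_{j_k}-t)`; rescale `h_k(s) := Q_k g(t_k + s/Q_k)`
(tree `IsRicciFlow.parabolicRescale`, `.comp_add_const`, `.mono`, `curvatureForm_constSmul`): on
`s ∈ [-t_k Q_k, B'_k/2]`, `B'_k := (T_{j_k}-t_k)Q_k → ∞`, `|Rm_{h_k}| ≤ 4`, anchor `= 1` at `(x_k, 0)`;
rescale once more by `4`: `|Rm| ≤ 1`, `c = 1/4`, `A_k := 4 t_k Q_k ≥ 2 T Q_k → ∞`, `B_k := 2 B'_k → ∞`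
(pass to a subsequence to get `≥ k`); floor: `μ(λ g, τ) = μ(g, τ/λ)` (tree `muEntropy_constSmul'`), so
`δ' = δ`. Two-sided analogue of the LANDED `stub_pointPicking` (p71490) + `stub_rescaledSequence` (p71836).
Size M. [cite: Hamilton1995, §16] -/
theorem stub_typeIITwoSidedSequence :
    ∀ (M : Type) [TopologicalSpace M] [T2Space M] [SecondCountableTopology M]
      [ChartedSpace (EuclideanSpace ℝ (Fin 4)) M] [IsManifold (𝓡 4) ∞ M] [CompactSpace M]
      [ConnectedSpace M] [T3Space M] [MeasurableSpace M] [BorelSpace M] (T δ : ℝ), 0 < δ →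
      ∀ (g : ℝ → PseudoRiemannianMetric (𝓡 4) ∞ (EuclideanSpace ℝ (Fin 4)) (TangentSpace (𝓡 4) : M → Type _))
        (cov : ℝ → CovariantDerivative (𝓡 4) (EuclideanSpace ℝ (Fin 4)) (TangentSpace (𝓡 4) : M → Type _)),
      IsMaximalRicciFlow g cov T →
      (¬ ∃ C : ℝ, ∀ t ∈ Set.Ico 0 T, CurvatureBoundedBy (g t) (cov t) (C / (T - t))) →
      (∀ t ∈ Set.Ico 0 T, ∀ τ : ℝ, 0 < τ →
        ((Real.log 2 + Real.log Real.pi / 2 - 3 / 2 + δ : ℝ) : EReal) ≤ (g t).muEntropy (cov t) τ) →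
      ∃ (c δ' : ℝ), 0 < c ∧ 0 < δ' ∧
        ∃ (A B : ℕ → ℝ)
          (gk : ℕ → ℝ → PseudoRiemannianMetric (𝓡 4) ∞ (EuclideanSpace ℝ (Fin 4)) (TangentSpace (𝓡 4) : M → Type _))
          (covk : ℕ → ℝ → CovariantDerivative (𝓡 4) (EuclideanSpace ℝ (Fin 4)) (TangentSpace (𝓡 4) : M → Type _))
          (xk : ℕ → M),
          (∀ k : ℕ, (k : ℝ) ≤ A k) ∧ (∀ k : ℕ, (k : ℝ) ≤ B k) ∧
          (∀ k, IsRicciFlow (gk k) (covk k) (Set.Icc (-(A k)) (B k))) ∧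
          (∀ k, ∀ t ∈ Set.Icc (-(A k)) (B k), (gk k t).IsRiemannian) ∧
          (∀ k, ∀ t ∈ Set.Icc (-(A k)) (B k), CurvatureBoundedBy (gk k t) (covk k t) 1) ∧
          (∀ k, ∃ X Y Z W : TangentSpace (𝓡 4) (xk k),
            (gk k 0).val (xk k) X X ≤ 1 ∧ (gk k 0).val (xk k) Y Y ≤ 1 ∧
            (gk k 0).val (xk k) Z Z ≤ 1 ∧ (gk k 0).val (xk k) W W ≤ 1 ∧
            c ≤ |(gk k 0).curvatureForm (covk k 0) (xk k) X Y Z W|) ∧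
          (∀ k, ∀ t ∈ Set.Icc (-(A k)) (B k), ∀ τ : ℝ, 0 < τ →
            ((Real.log 2 + Real.log Real.pi / 2 - 3 / 2 + δ' : ℝ) : EReal) ≤
              (gk k t).muEntropy (covk k t) τ) := by
  sorry

/-! ## Stub 4 — Type II: the ETERNAL CEILING in blow-down form (singularity models, sequence level) -/

/-- **Stub 4 (`stub_twoSidedBlowdown`) — HARDEST; the card's ETERNAL CEILING, sharpened (TRIAGE r1-1/2/3)
to singularity models of compact flows and put in blow-down form.** On a closed connected 4-manifold
`M`, let `g_k` be Ricci flows on `[-A_k, B_k]`, `A_k, B_k ≥ k`, Riemannian, `|Rm| ≤ 1`, with an anchor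
`|Rm_{g_k(0)}|(x_k) ≥ c > 0` and the floor `μ(g_k(t), τ) ≥ ν_cyl + δ'` throughout. Then there is a
complete connected NON-COMPACT gradient shrinker in the currency of item 10868 — `Ric + Hess f = g/2`,
`R + |∇f|² = f`, `f` smooth, closed balls compact, `R ≢ 0` — of density `∫ e^{-f} dV > 32π²√π e^{-3/2}`.
(So, GIVEN `NoncompactShrinkerGap`, super-cylindrical two-sided sequences do not exist: `EntropyTypeI_of`.)
PROOF IN PRINT. (a) Blow-down: the backward halves `g_k|[-A_k, 0]` are exactly the input of the LANDED
named fact `Literature.Geometry.Riemannian.bamler_orbifoldTangentFlowAtInfinity_four` (Bamler 2020a Prop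
5.2 display, Thm 10.1; 2020b; 2020c Thms 2.4, 2.9, 2.16, 2.40, 2.46) with `F = ν_cyl + δ'`: a tangent flow
at `-∞` of the 𝔽-limit, realised as an 𝔽-limit of rescalings of the COMPACT flows (2020c §2.7; BCDMZ
arXiv:2102.04649, proof of Prop 4), is a smooth orbifold shrinker with `W := 𝒩(∞) ≥ F` and `W < 0`
(anchor); a cone point of order `|Γ| ≥ 2` would force `μ ≤ -log|Γ| + o(1) ≤ -log 2 < ν_cyl + δ'` on a
rescaled compact slice (the sibling line's fact-free kit `stub_muEntropyTestFunction`,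
`stub_injOnVolumeComparison`, `stub_multiplicityLintegral`, `stub_coneAnnulusArithmetic` and its assembly;
margin `Disproof.half_lt_thetaCyl`), so the shrinker `S` is smooth, complete, connected, `R > 0`,
`∫e^{-f} = 16π²`, and `stub_renormalise` (LANDED p74584) puts it in the route's currency with density
`16π² e^{W} > 16π² Θ_cyl`. (b) `S` is NOT compact — this is where the forward halves (`B_k → ∞`, i.e.
ETERNITY of the Type-II model) bite: if `S` were compact, the convergence at time `-1` of the rescalings
`λ_j⁻¹ g_{k_j}(λ_j ·)` is smooth and GLOBAL (2020c Thm 2.4 on the compact regular slice `S × {-1}`; the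
landed fact already exports the injective immersion `S → M`, here one also uses the printed convergence of
curvature), so for `j` large the compact slice `(M, g_{k_j}(-λ_j))` has `R ≥ ρ/(2λ_j)` with
`ρ := min_S R_S > 0` (a compact shrinker with `R ≢ 0` has `R > 0`: elliptic maximum principle for
`ΔR - ⟨∇f,∇R⟩ = R - 2|Ric|²`, B.-L. Chen 2009 Cor 2.5; cf. the tree's in-progress
`Theorems/EntropyRungCompactShrinkerGapScalarCurvaturePos.lean`); by Topping 2006 Cor 3.2.4 (tree `IsRicciFlow.singularTime_le`) the flow
`g_{k_j}` cannot exist beyond time `-λ_j + 4λ_j/ρ`, contradicting smooth existence with `|Rm| ≤ 1` up to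
`B_{k_j} → ∞` (choose `k_j` with `B_{k_j} > 4λ_j/ρ`). STEADY SECTOR (for orientation only, not a stub,
TRIAGE-r1-3): if the Type-II model is a steady soliton, BCDMZ Prop 4 gives the blow-down
`∈ {ℝ⁴/Γ, S³/Γ×ℝ, S²×ℝ², ((S²×ℝ)/ℤ₂)×ℝ}`, all of density `≤ Θ(S³×ℝ)` — the ceiling is sharp at the 4-d
Bryant soliton (blow-down `S³×ℝ`, `Θ = Θ_cyl`, excluded only by the STRICT floor). CAVEAT recorded: the
conclusion does not mention the data (cf. Disproof §8.1 for the sibling's `stub_blowdown`): it is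
trivially true if #2 fails, and given #2 it says the hypotheses are unsatisfiable — no junk model of the
hypotheses is known on any closed `M⁴` (they require a Type-II singularity above the cylinder entropy:
degenerate neckpinches carry necks, `ν ≤ ν_cyl`; Appleton's Eguchi–Hanson models have `ν ≤ -log 2`).
Size XL. [cite: Bamler2020Structure, Thm 2.4, 2.16, 2.40, 2.46] [cite: Bamler2020Entropy, Prop 5.2, Thm 10.1]
[cite: Bamler2023, Thm 1.2] [cite: Topping2006, Cor 3.2.4] -/
theorem stub_twoSidedBlowdown :
    ∀ (M : Type) [TopologicalSpace M] [T2Space M] [SecondCountableTopology M]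
      [ChartedSpace (EuclideanSpace ℝ (Fin 4)) M] [IsManifold (𝓡 4) ∞ M] [CompactSpace M]
      [ConnectedSpace M] [T3Space M] [MeasurableSpace M] [BorelSpace M]
      (A B : ℕ → ℝ)
      (gk : ℕ → ℝ → PseudoRiemannianMetric (𝓡 4) ∞ (EuclideanSpace ℝ (Fin 4)) (TangentSpace (𝓡 4) : M → Type _))
      (covk : ℕ → ℝ → CovariantDerivative (𝓡 4) (EuclideanSpace ℝ (Fin 4)) (TangentSpace (𝓡 4) : M → Type _))
      (xk : ℕ → M) (δ' c : ℝ), 0 < δ' → 0 < c →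
      (∀ k : ℕ, (k : ℝ) ≤ A k) → (∀ k : ℕ, (k : ℝ) ≤ B k) →
      (∀ k, IsRicciFlow (gk k) (covk k) (Set.Icc (-(A k)) (B k))) →
      (∀ k, ∀ t ∈ Set.Icc (-(A k)) (B k), (gk k t).IsRiemannian) →
      (∀ k, ∀ t ∈ Set.Icc (-(A k)) (B k), CurvatureBoundedBy (gk k t) (covk k t) 1) →
      (∀ k, ∃ X Y Z W : TangentSpace (𝓡 4) (xk k),
        (gk k 0).val (xk k) X X ≤ 1 ∧ (gk k 0).val (xk k) Y Y ≤ 1 ∧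
        (gk k 0).val (xk k) Z Z ≤ 1 ∧ (gk k 0).val (xk k) W W ≤ 1 ∧
        c ≤ |(gk k 0).curvatureForm (covk k 0) (xk k) X Y Z W|) →
      (∀ k, ∀ t ∈ Set.Icc (-(A k)) (B k), ∀ τ : ℝ, 0 < τ →
        ((Real.log 2 + Real.log Real.pi / 2 - 3 / 2 + δ' : ℝ) : EReal) ≤
          (gk k t).muEntropy (covk k t) τ) →
      ∃ (S : Type) (_ : TopologicalSpace S) (_ : T2Space S) (_ : SecondCountableTopology S)
        (_ : ChartedSpace (EuclideanSpace ℝ (Fin 4)) S) (_ : IsManifold (𝓡 4) ∞ S) (_ : ConnectedSpace S)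
        (_ : NoncompactSpace S) (_ : T3Space S) (_ : MeasurableSpace S) (_ : BorelSpace S)
        (gS : PseudoRiemannianMetric (𝓡 4) ∞ (EuclideanSpace ℝ (Fin 4)) (TangentSpace (𝓡 4) : S → Type _))
        (_ : gS.HasLeviCivita) (fS : S → ℝ) (hS : gS.IsRiemannian),
        (∀ (x : S) (r : NNReal), IsCompact {y : S | gS.edist hS x y ≤ r}) ∧
        ContMDiff (𝓡 4) 𝓘(ℝ, ℝ) ∞ fS ∧
        (∀ (x : S) (X Y : TangentSpace (𝓡 4) x),
          gS.ricci x X Y + gS.hessian fS x X Y = (1 / 2 : ℝ) * gS.val x X Y) ∧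
        (∀ x : S, gS.scalarCurvature x + gS.gradSq fS x = fS x) ∧
        (∃ x : S, gS.scalarCurvature x ≠ 0) ∧
        ENNReal.ofReal (32 * Real.pi ^ 2 * Real.sqrt Real.pi * Real.exp (-(3 : ℝ) / 2)) <
          ∫⁻ x, ENNReal.ofReal (Real.exp (-fS x))
            ∂(riemannianMeasure (gS.toContMDiffRiemannianMetric hS)) := by
  sorry

/-! ## Composition — all sorry-free from here on -/

/-- **`TypeIRung` from Stubs 1–2, the landed compact-model recognition, #2 (bounded-curvature form) and
#4.** Blow up the (Type-I) maximal flow at a singular point (Stub 2): a non-compact blow-down of bounded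
curvature and density `> Θ_cyl` contradicts `NoncompactShrinkerGapBdd`; a compact one immerses injectively
into the connected `M`, hence `S ≅ M ≃ₕ S⁴` (`stub_compactModelRecognition`, p72507), and
`CompactShrinkerGap` gives `S ≃ₘ S⁴`. [folklore] -/
theorem TypeIRung_of (h₂ : NoncompactShrinkerGapBdd)
    (h₄ : _root_.Summit.SmoothPoincare4.SmoothPoincare4.Theses.EntropyRung.CompactShrinkerGap) :
    TypeIRung := by
  intro M _ _ _ _ _ _ _ _ _ e g _ hg hR hν hTypeI
  -- `M ≃ₕ S⁴` ⇒ `M` (path) connected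
  haveI : PathConnectedSpace (Metric.sphere (0 : EuclideanSpace ℝ (Fin 5)) 1) :=
    Literature.Topology.FourManifolds.pathConnectedSpace_sphere_four
  haveI : PathConnectedSpace M :=
    Literature.Topology.FourManifolds.pathConnectedSpace_of_homotopyEquiv e
  obtain ⟨δ, hδ, hfloor⟩ := hν
  -- Stub 1: a maximal flow exists; every maximal flow blows up and keeps the floor
  obtain ⟨⟨T, gt, cov, hmax, h0⟩, hall⟩ := stub_maximalFlow M g hg hR δ hδ hfloor
  obtain ⟨hblow, hfl⟩ := hall T gt cov hmax h0
  -- the Type-I hypothesis for this flow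
  have hI : ∃ C : ℝ, ∀ t ∈ Set.Ico 0 T, CurvatureBoundedBy (gt t) (cov t) (C / (T - t)) :=
    hTypeI T gt cov hmax h0
  -- Stub 2: Mantegazza–Müller blow-down in the route's currency
  obtain ⟨S, _, _, _, _, _, _, _, _, _, gS, _, fS, hS, hScomplete, hfS, hsol, hnorm, hSnonflat, hdens,
      hbdd, hScouple⟩ :=
    stub_typeIBlowdown M T δ hδ gt cov hmax hblow hI hfl
  by_cases hSc : CompactSpace S
  · -- compact blow-down: `S ≅ M ≃ₕ S⁴`, then `CompactShrinkerGap`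
    obtain ⟨φ, hφ, hφinj, hφimm⟩ := hScouple hSc
    obtain ⟨eSM⟩ :=
      _root_.Summit.SmoothPoincare4.SmoothPoincare4.Theorems.SubcylindricalRecognition.AncientSphereRigidity.stub_compactModelRecognition
        S M φ hφ hφinj hφimm
    have eS4 : S ≃ₕ Metric.sphere (0 : EuclideanSpace ℝ (Fin 5)) 1 :=
      eSM.toHomeomorph.toHomotopyEquiv.trans e
    obtain ⟨eS⟩ := h₄ S eS4 gS fS hS hfS hsol hnorm hdens
    exact ⟨eSM.symm.trans eS⟩
  · -- non-compact blow-down of bounded curvature: forbidden by `NoncompactShrinkerGapBdd`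
    haveI : NoncompactSpace S := not_compactSpace_iff.mp hSc
    have hle := h₂ S gS fS hS hScomplete hfS hsol hnorm hSnonflat hbdd
    exact absurd hdens (not_lt.mpr hle)

/-- **`EntropyTypeI` from Stubs 1, 3, 4 and #2 only** ("super-cylindrical entropy forbids Type II",
modulo the non-compact density gap): a Type-II maximal flow above the cylinder yields a two-sided
sequence (Stub 3), whose blow-down is a non-compact dense shrinker (Stub 4) — against
`NoncompactShrinkerGap`. `CompactShrinkerGap` is not used. [folklore] -/
theorem EntropyTypeI_of
    (h₂ : _root_.Summit.SmoothPoincare4.SmoothPoincare4.Theses.EntropyRung.NoncompactShrinkerGap) :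
    EntropyTypeI := by
  intro M _ _ _ _ _ _ _ _ _ _ g _ hg hR hν T gt cov hmax h0
  obtain ⟨δ, hδ, hfloor⟩ := hν
  obtain ⟨-, hall⟩ := stub_maximalFlow M g hg hR δ hδ hfloor
  obtain ⟨-, hfl⟩ := hall T gt cov hmax h0
  by_contra hII
  -- Stub 3: Hamilton's Type-II picking, two-sided rescaled sequence with the floor
  obtain ⟨c, δ', hc, hδ', A, B, gk, covk, xk, hA, hB, hflow, hRiem, hcurv, hpt, hfl'⟩ :=
    stub_typeIITwoSidedSequence M T δ hδ gt cov hmax hII hfl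
  -- Stub 4: its blow-down is a non-compact dense shrinker
  obtain ⟨S, _, _, _, _, _, _, _, _, _, _, gS, _, fS, hS, hScomplete, hfS, hsol, hnorm, hSnonflat,
      hdens⟩ :=
    stub_twoSidedBlowdown M A B gk covk xk δ' c hδ' hc hA hB hflow hRiem hcurv hpt hfl'
  -- forbidden by `NoncompactShrinkerGap`
  have hle := h₂ S gS fS hS hScomplete hfS hsol hnorm hSnonflat
  exact absurd hdens (not_lt.mpr hle)

/-- **RUNG from the line** (the card's first lemma `rung_of_typeSplit`, inlined). `SubcylindricalRecognition`
(stmt-SmoothPoincare4-10869) follows from the four registered stubs and the crux's two declared route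
dependencies `NoncompactShrinkerGap` (stmt-SmoothPoincare4-10868) and `CompactShrinkerGap`
(stmt-SmoothPoincare4-10870), taken as hypotheses BY NAME: RUNG ⇐ `TypeIRung` ∧ `EntropyTypeI` by pure
logic (`M ≃ₕ S⁴` makes `M` connected, tree `pathConnectedSpace_of_homotopyEquiv`; every maximal flow from
`g` is Type I by `EntropyTypeI_of h₂`, and then `TypeIRung_of` recognises `S⁴`). The homotopy equivalence
is used twice (connectedness; `S ≃ₕ S⁴` inside `TypeIRung_of`), as `Disproof.false_without_homotopyEquiv`
demands. [folklore] -/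
theorem SubcylindricalRecognition_of
    (h₂ : _root_.Summit.SmoothPoincare4.SmoothPoincare4.Theses.EntropyRung.NoncompactShrinkerGap)
    (h₄ : _root_.Summit.SmoothPoincare4.SmoothPoincare4.Theses.EntropyRung.CompactShrinkerGap) :
    _root_.Summit.SmoothPoincare4.SmoothPoincare4.Theses.EntropyRung.SubcylindricalRecognition := by
  have hI : TypeIRung := TypeIRung_of (noncompactShrinkerGapBdd_of h₂) h₄
  have hII : EntropyTypeI := EntropyTypeI_of h₂
  intro M _ _ _ _ _ _ _ _ _ e g _ hg hR hν
  haveI : PathConnectedSpace (Metric.sphere (0 : EuclideanSpace ℝ (Fin 5)) 1) :=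
    Literature.Topology.FourManifolds.pathConnectedSpace_sphere_four
  haveI : PathConnectedSpace M :=
    Literature.Topology.FourManifolds.pathConnectedSpace_of_homotopyEquiv e
  exact hI M e g hg hR hν (fun T gt cov hmax h0 ↦ hII M g hg hR hν T gt cov hmax h0)

end Summit.SmoothPoincare4.SmoothPoincare4.Cruxes.SubcylindricalRecognition.TypeSplitBryantCeiling

end
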